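import Literature.Computability.Complexity.BoundedArithmeticConservation
import Literature.ModelTheory.UniversalTheories.HerbrandSaturation
import HarnessLib

/-!
# Buss's conservation theorem via Herbrand saturation: the abstract route

Trunk: CplxMeta / family `pnp` (support for the named fact
`Literature.Computability.Complexity.S2_succ_isConservativeOver_T2`, continued from `BoundedArithmeticConservation.lean`).

The model-theoretic proofs of Buss's theorem "`S₂ⁱ⁺¹` is `∀Σᵇᵢ₊₁`-conservative over `T₂ⁱ`"
(Zambella 1996; Krajíček 1995, Thm. 7.6.3 and pp. 116–117; in the abstract form of Avigad 2002,
§§3–4) all run as follows: pass to a universal conservative extension `U ⊇ T₂ⁱ` by definable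
functions (`PVᵢ₊₁` of Krajíček–Pudlák–Takeuti 1991), in which `Πᵇᵢ₊₁` formulas become
universal; embed a model of `U` into an *Herbrand-saturated* model of `U` preserving universal
formulas (Avigad 2002, Thm. 3.2); and show that Herbrand-saturated models of `U` satisfy
`Σᵇᵢ₊₁-PIND` (the witnessing argument).  This file proves the route *abstractly*: the three
arithmetic inputs are isolated as the structure `Literature.PNP.HerbrandRouteData i ι U` (for an
arbitrary language extension `ι : Language.boundedArith →ᴸ L'` and universal `L'`-theory `U`),
and `Literature.Computability.Complexity.t2_hasPibPreservingMap_S2_succ_of_herbrandRouteData` derives the model-theoretic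
form `T2_hasPibPreservingMap_S2_succ` of Buss's theorem (hence, by
`S2_succ_isConservativeOver_T2_of_hasPibPreservingMap`, the theorem itself) from such data for
all `i ≥ 1`, using `Literature/ModelTheory/UniversalTheories/HerbrandSaturation.lean`.

Supplying `HerbrandRouteData i` for a concrete `PVᵢ₊₁`-style expansion is the remaining
(bootstrapping) work: Buss 1990, §3 (Thms. 8–12) / Krajíček 1995, Thm. 5.3.5 for the expansion,
and the argument of Krajíček 1995, pp. 116–117 for the saturated models.

## References

* J. Avigad, *Saturated models of universal theories*, Ann. Pure Appl. Logic 118 (2002), §§3–4.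
* J. Krajíček, *Bounded Arithmetic, Propositional Logic and Complexity Theory*, CUP 1995,
  Thm. 5.3.5, Thm. 7.6.3, pp. 116–117.
* J. Krajíček, P. Pudlák, G. Takeuti, *Bounded arithmetic and the polynomial hierarchy*,
  Ann. Pure Appl. Logic 52 (1991), §1.
* D. Zambella, *Notes on polynomially bounded arithmetic*, J. Symbolic Logic 61 (1996).

## Design choices

* `L'` is taken in `Language.{0, 0}` (symbol types in `Type`), so that the Herbrand-saturated
  models produced by `exists_preservesUniversal_isHerbrandSaturated` live in `Type`, the universe
  of `T2_hasPibPreservingMap_S2_succ`.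
* The second input is split into its two directions exactly as they are used: `Πᵇᵢ₊₁ → universal`
  in expanded models of `T₂ⁱ`, and `universal → Πᵇᵢ₊₁` in the Herbrand-saturated models of `U`
  (the only models of `U` the route ever looks at).
-/

open FirstOrder FirstOrder.Language FirstOrder.Language.BoundedFormula

namespace Literature.Computability.Complexity.ModelTheory

variable {L : Language} {α : Type*} {n : ℕ}

/-- Universal formulas are preserved by `toFormula`. [folklore] -/
theorem _root_.FirstOrder.Language.BoundedFormula.IsUniversal.toFormula {φ : L.BoundedFormula α n}
    (h : φ.IsUniversal) : φ.toFormula.IsUniversal := by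
  induction h with
  | of_isQF h => exact h.toFormula.isUniversal
  | all _ ih => exact (ih.relabel _).all

variable {M : Type*} {N : Type*} [L.Structure M] [L.Structure N]

/-- A map preserving universal formulas with parameters preserves every universal formula in
context variables, instance-wise: `M ⊨ ψ(ā)` implies `N ⊨ ψ(f ā)`. [folklore] -/
theorem _root_.Literature.ModelTheory.UniversalTheories.PreservesUniversal.realize_boundedFormula {f : M → N} (hf : Literature.ModelTheory.UniversalTheories.PreservesUniversal L f)
    {ψ : L.BoundedFormula Empty n} (hψ : ψ.IsUniversal) (xs : Fin n → M)
    (h : ψ.Realize default xs) : ψ.Realize default (f ∘ xs) := by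
  have hU : (Formula.relabel (Sum.elim Empty.elim xs) ψ.toFormula).IsUniversal :=
    hψ.toFormula.formulaRelabel _
  have h1 : (Formula.relabel (Sum.elim Empty.elim xs) ψ.toFormula).Realize (_root_.id : M → M) := by
    rw [Formula.realize_relabel, realize_toFormula,
      Subsingleton.elim ((_root_.id ∘ Sum.elim Empty.elim xs) ∘ Sum.inl) default]
    exact h
  have h2 := hf hU h1
  rw [Formula.realize_relabel, realize_toFormula,
    Subsingleton.elim ((f ∘ Sum.elim Empty.elim xs) ∘ Sum.inl) default] at h2
  exact h2

end Literature.Computability.Complexity.ModelTheory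

namespace Literature.Computability.Complexity

open MetaComplexity Literature.ModelTheory.UniversalTheories

/-- **Data for the Herbrand-saturation route to Buss's theorem at level `i`.**  For a language
extension `ι : Language.boundedArith →ᴸ L'` and an `L'`-theory `U` (think: `PVᵢ₊₁`):
* `isUniversal`: `U` is universal;
* `expands`: every model of `T₂ⁱ` expands along `ι` to a model of `U`
  (cf. Krajíček 1995, Thm. 5.3.5: `PVᵢ₊₁` is conservative over `T₂ⁱ` by definitions);
* `exists_universal`: every `Πᵇᵢ₊₁` formula `φ` has a universal `L'`-companion `ψ` with `φ → ψ`
  in expanded models of `T₂ⁱ` and `ψ → φ` in the Herbrand-saturated models of `U`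
  (in `PVᵢ₊₁`, `Σᵇᵢ` formulas are quantifier-free and `Σᵇᵢ`-Skolem functions are available;
  in an Herbrand-saturated model sharply bounded collection for open formulas holds — Avigad 2002,
  Thm. 3.3 plus sequence-collecting terms — which puts `Σᵇᵢ₊₁` formulas in strict form);
* `model_S2_succ`: every Herbrand-saturated model of `U` is, on its `ι`-reduct, a model of `S₂ⁱ⁺¹`
  (Krajíček 1995, Thm. 7.6.3 / Zambella 1996; Avigad 2002, §4).
[cite: Krajicek1995, Thm. 5.3.5, Thm. 7.6.3 and pp. 116–117] [cite: Avigad2002, §4] -/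
structure HerbrandRouteData (i : ℕ) {L' : Language.{0, 0}} (ι : Language.boundedArith →ᴸ L')
    (U : L'.Theory) : Prop where
  /-- `U` is a universal theory. -/
  isUniversal : U.IsUniversal
  /-- Every model of `T₂ⁱ` expands to a model of `U`. -/
  expands : ∀ (M : Type) [Language.boundedArith.Structure M], M ⊨ T2 i →
    ∃ s : L'.Structure M, @LHom.IsExpansionOn _ _ ι M _ s ∧ @Theory.Model L' M s U
  /-- `Πᵇᵢ₊₁` formulas have universal companions. -/
  exists_universal : ∀ {n : ℕ} (φ : Language.boundedArith.BoundedFormula Empty n),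
    IsPib (i + 1) φ → ∃ ψ : L'.BoundedFormula Empty n, ψ.IsUniversal ∧
      (∀ (M : Type) [Language.boundedArith.Structure M] [L'.Structure M], ι.IsExpansionOn M →
        M ⊨ T2 i → M ⊨ U → ∀ xs : Fin n → M, φ.Realize default xs → ψ.Realize default xs) ∧
      (∀ (K : Type) [L'.Structure K], K ⊨ U → IsHerbrandSaturated L' K → ∀ xs : Fin n → K,
          ψ.Realize default xs → (ι.onBoundedFormula φ).Realize default xs)
  /-- Herbrand-saturated models of `U` are models of `S₂ⁱ⁺¹`. -/
  model_S2_succ : ∀ (K : Type) [L'.Structure K], K ⊨ U → IsHerbrandSaturated L' K →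
    @Theory.Model Language.boundedArith K (ι.reduct K) (S2 (i + 1))

/-- **The Herbrand-saturation route, abstractly.**  If for every `i ≥ 1` some language
extension `ι i` and universal theory `U i` carry `HerbrandRouteData i`, then every model of
`T₂ⁱ` maps `Πᵇᵢ₊₁`-preservingly into a model of `S₂ⁱ⁺¹` (`T2_hasPibPreservingMap_S2_succ`):
expand `M ⊨ T₂ⁱ` to `U i`, map it into an Herbrand-saturated `K ⊨ U i` preserving universal
formulas (Avigad 2002, Thm. 3.2, `exists_preservesUniversal_isHerbrandSaturated`), and read
`Πᵇᵢ₊₁` formulas through their universal companions (Krajíček 1995, pp. 116–117; Zambella 1996).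
[cite: Krajicek1995, pp. 116–117] [cite: Avigad2002, Theorem 3.2] -/
theorem t2_hasPibPreservingMap_S2_succ_of_herbrandRouteData
    {L' : ℕ → Language.{0, 0}} (ι : ∀ i, Language.boundedArith →ᴸ L' i)
    (U : ∀ i, (L' i).Theory) (H : ∀ ⦃i : ℕ⦄, 1 ≤ i → HerbrandRouteData i (ι i) (U i)) :
    T2_hasPibPreservingMap_S2_succ := by
  intro i hi M _ hM
  have Hi := H hi
  obtain ⟨s, hexpOn, hMU⟩ := Hi.expands M hM
  letI : (L' i).Structure M := s
  haveI : (U i).IsUniversal := Hi.isUniversal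
  haveI : M ⊨ U i := hMU
  haveI : Nonempty M := nonempty_of_structure M
  obtain ⟨K, _, _, f, hf, hK⟩ := exists_preservesUniversal_isHerbrandSaturated (L := L' i) M
  have hKU : K ⊨ U i := hf.model_of_isUniversal (U i)
  letI : Language.boundedArith.Structure K := (ι i).reduct K
  refine ⟨K, (ι i).reduct K, f, Hi.model_S2_succ K hKU hK, fun n φ hφ xs hx => ?_⟩
  obtain ⟨ψ, hψU, hφψ, hψφ⟩ := Hi.exists_universal φ hφ
  have h1 : ψ.Realize default xs := hφψ M hexpOn hM hMU xs hx
  have h2 : ψ.Realize default (f ∘ xs) := hf.realize_boundedFormula hψU xs h1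
  have h3 := hψφ K hKU hK (f ∘ xs) h2
  rwa [LHom.realize_onBoundedFormula] at h3

/-- **Corollary.**  Herbrand-route data for all `i ≥ 1` prove Buss's conservation theorem
`S2_succ_isConservativeOver_T2` (Buss 1990, Thm. 5), via
`S2_succ_isConservativeOver_T2_of_hasPibPreservingMap`. [cite: BussContempMath1990, Thm. 5] -/
theorem S2_succ_isConservativeOver_T2_of_herbrandRouteData
    {L' : ℕ → Language.{0, 0}} (ι : ∀ i, Language.boundedArith →ᴸ L' i)
    (U : ∀ i, (L' i).Theory) (H : ∀ ⦃i : ℕ⦄, 1 ≤ i → HerbrandRouteData i (ι i) (U i)) :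
    S2_succ_isConservativeOver_T2 :=
  S2_succ_isConservativeOver_T2_of_hasPibPreservingMap
    (t2_hasPibPreservingMap_S2_succ_of_herbrandRouteData ι U H)

end Literature.Computability.Complexity
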